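import Literature.NumberTheory.Automorphic.ShimuraCurveRibetTakahashiPairwiseDenominatorProofs
import Literature.NumberTheory.Automorphic.ShimuraParametrizationRelativeProofs
import Literature.NumberTheory.Automorphic.ShimuraParametrizationIsogenyProofs
import HarnessLib

/-!
# Pasten's two-prime package without the Jacquet–Langlands existence fact

Topic `NumberTheory/Automorphic`; a proofs-only companion (theorems only: no definition, no named
fact, nothing restated; D-0026) of `ShimuraCurveRibetTakahashi.lean`, for its named facts
`Literature.NumberTheory.Automorphic.nonempty_shimuraParametrizationData` (H. Pasten, *Shimura
curves and the abc conjecture*, J. Number Theory 254 (2024) = arXiv:1705.09251, §2 p. 12: "the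
Jacquet–Langlands correspondence gives an optimal quotient `q_{D,M} : J₀^D(M) → A_{D,M}`") and
`Literature.NumberTheory.Automorphic.PastenShimura2024_pairwise_denominator` (§6.9
(EqSequentially) p. 25 at `d = 1`, with Lemmas 6.8, 6.14, 6.15).

**The point.** The tree's assembly of the two-prime package
(`ShimuraCurveRibetTakahashiPairwiseDenominatorProofs.lean`) takes the Jacquet–Langlands existence
fact `hP : nonempty_shimuraParametrizationData` as a hypothesis, but — as its own docstring records
("the latter only at `D = 1`") — applies it only at the SPLIT level `(1, N)`: once in
`PastenShimura2024_pairwise_denominator_of_lemmas` (a class-minimal datum on `X₀^1(N)`, Pasten's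
`q_{1,N} j_N`), and once inside `PastenShimura2024_lemma_6_15` at the level `(D/(pr), prM)`, which
for `D = pq` is again `(1, N)`. At `D = 1` the fact is NOT an input: the statement of the package
itself quantifies over a classical datum `D₁ : ModularParametrizationData W₁ N` with
`IsNewformOf W D₁.f` (the tree's idiom for `δ_{1,N}`), and such a datum transports to every
presentation `X : ShimuraCurveData 1 N` of `X₀(N)` and to every curve of the isogeny class — the
tree's theorems `nonempty_shimuraParametrizationData_one_of_modularParametrizationData`
(`ShimuraParametrizationRelativeProofs`: Pasten's "`X₀^1(N) = X₀(N)`", §2 p. 12, for an arbitrary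
`(B, O, ι)`), `isIsogenous_of_lFunction_prime_eq_of_not_dvd` (Faltings) and
`ShimuraParametrizationData.nonempty_of_isIsogenous` (`ShimuraParametrizationIsogenyProofs`:
"composing with an isogeny `A → E`", proof of Prop. 5.1 p. 17). This file performs that
substitution, so that `nonempty_shimuraParametrizationData` (the Modularity theorem plus, for
`D > 1`, the Jacquet–Langlands transfer and Shimura's construction — an apex of the tree) LEAVES
the list of inputs of `PastenShimura2024_pairwise_denominator`. What is proved (sorry-free):

* `nonempty_shimuraParametrizationData_one_of_isNewformOf` — **the fact at `D = 1`, relative to a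
  modular parametrisation of ANY curve with the same newform**: for `X : ShimuraCurveData 1 N`,
  `W, W₁` elliptic, `D₁ : ModularParametrizationData W₁ N` with `IsNewformOf W D₁.f`, a datum of `W`
  on `X` exists (`W₁ ∼ W` by Faltings since `aₙ(W₁) = aₙ(D₁.f) = aₙ(W)`); and its level-transport
  form `nonempty_shimuraParametrizationData_of_isNewformOf_of_eq_one` (level `(d, M₁)`, `d = 1`);
* `PastenShimura2024_lemma_6_15_of_supply` — **Lemma 6.15 with the Jacquet–Langlands fact replaced
  by the one datum its proof uses**: a datum of `E` on the curve `X₀^{D/(pr)}(prM)` (needed only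
  for `p ≠ r`); otherwise verbatim the tree's `PastenShimura2024_lemma_6_15`;
* `PastenShimura2024_pairwise_denominator_of_lemmas_of_supply` — the tree's
  `PastenShimura2024_pairwise_denominator_of_lemmas` WITHOUT `hP`, the datum on `X₀^1(N)` now coming
  from `D₁`, and with the Lemma 6.15 hypothesis `h615` in the supplied form;
* `PastenShimura2024_pairwise_denominator_of_ribetTakahashi_inputs_noJL`,
  `PastenShimura2024_pairwise_denominator_of_ribetTakahashi_eisenstein_mazurKenku_noJL` — **the
  two-prime package from Prop. 6.13 (`h613`), "`j_p ∣ c_p(A_{D,M})`" (`hJc`), the Eisenstein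
  divisibility (`hEis`), Lemma 6.7 (`h67`) and Mazur–Kenku ALONE**: the trust base of
  `ShimuraCurveRibetTakahashiPairwiseDenominatorProofs` §IV minus `nonempty_shimuraParametrizationData`.

So after this file the discharge `PastenShimura2024_pairwise_denominator_holds` waits exactly for
the vocabulary of Néron models / component groups defining `cI`, `cJ` and, over it, `h613`
(Ribet–Takahashi 1997 Thm. 2), `hJc`, `hEis` (Ribet), `h67` (Pasten's Lemma 6.7), and the named fact
`mazurKenku_exists_cyclic_isogeny` — and for nothing automorphic. (The summit-side consumer
`stub_twoPrimePackage_of_facts` still uses `nonempty_shimuraParametrizationData` at the level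
`(pq, M)` itself, for the quaternionic form `s` in its conclusion: that use is the genuine
Jacquet–Langlands input and is not touched here.)

## References

* H. Pasten, *Shimura curves and the abc conjecture*, J. Number Theory 254 (2024) 214–335 =
  arXiv:1705.09251: §2 p. 12, Prop. 5.1 p. 17, Lemma 6.8 p. 22, Prop. 6.13 and Lemma 6.14 p. 23,
  Lemma 6.15 p. 24, §6.9 (EqSequentially) p. 25 (held arXiv text, read). [PastenShimura2024]
* K. A. Ribet, S. Takahashi, PNAS 94 (1997) 11110–11114, Thm. 2. [RibetTakahashi1997]
* G. Faltings, Invent. Math. 73 (1983), §5 Kor. 2. [Faltings1983Endlichkeit]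
* B. Mazur, Invent. Math. 44 (1978), Thm. 1 [Mazur1978]; M. A. Kenku, J. Number Theory 15 (1982)
  [Kenku1982].

## Mathlib / tree search

Tree (reused): `nonempty_shimuraParametrizationData_one_of_modularParametrizationData`,
`isIsogenous_of_lFunction_prime_eq_of_not_dvd`, `ShimuraParametrizationData.nonempty_of_isIsogenous`,
`ShimuraParametrizationData.exists_isMinimalFor_of_nonempty`, `PastenShimura2024_lemma_6_14`,
`PastenShimura2024_lemma_6_8_of_mazurKenku'`, `lemma_6_8_factorization_form`,
`IsAdmissibleFactorization.erase_two_primes`, `.dvd_and_not_sq_dvd`, `.not_sq_dvd_mul_of_dvd`,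
`factorization_le_of_two_identities`, `factorization_le_of_dvd_of_mul_eq_mul`,
`dvd_gcd_mul_prod_pow_of_factorization_le`, `one_le_prod_pow_and_primeFactors_lt`,
`ShimuraParametrizationData.IsMinimalFor.deg_eq_modularDegree`, `nonempty_shimuraCurveData_holds`.
-/

noncomputable section

open scoped MatrixGroups ModularForm

namespace Literature.NumberTheory.Automorphic

open Literature.NumberTheory.EllipticCurves (mazurKenku_exists_cyclic_isogeny)
open Literature.NumberTheory.EllipticCurves.ModularForms (ModularParametrizationData IsNewformOf
  PastenShimura2024_lemma_6_8_of_mazurKenku')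

/-! ## I. The fact at `D = 1` from a modular parametrisation of any curve with the same newform -/

/-- **`nonempty_shimuraParametrizationData` at `D = 1` is a theorem relative to a modular
parametrisation of any curve of the class.** For a presentation `X : ShimuraCurveData 1 N` of
`X₀(N)`, elliptic `W, W₁ / ℚ` and a classical datum `D₁ : ModularParametrizationData W₁ N` whose
newform is that of `W` (`IsNewformOf W D₁.f`), there is a Shimura-curve parametrisation datum of `W`
on `X`: `aₙ(W₁) = aₙ(D₁.f) = aₙ(W)` for all `n` (`D₁.isNewformOf`, `IsNewformOf`), so `W₁ ∼ W`
(Faltings, `isIsogenous_of_lFunction_prime_eq_of_not_dvd`); `D₁` transports to `X`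
(`nonempty_shimuraParametrizationData_one_of_modularParametrizationData`, Pasten's
"`X₀^1(N) = X₀(N)`") and along the isogeny (`ShimuraParametrizationData.nonempty_of_isIsogenous`,
"composing `q ∘ j_{p₀}` with an isogeny `A → E`"). [cite: PastenShimura2024, §2 p. 12 (X₀^1(N) = X₀(N), A_{1,N} ∼ E) and proof of Prop. 5.1 p. 17] -/
theorem nonempty_shimuraParametrizationData_one_of_isNewformOf {N : ℕ} [NeZero N]
    (X : ShimuraCurveData 1 N) (W : WeierstrassCurve ℚ) [W.IsElliptic]
    {W₁ : WeierstrassCurve ℚ} [W₁.IsElliptic] (D₁ : ModularParametrizationData W₁ N)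
    (hf : IsNewformOf W D₁.f) : Nonempty (ShimuraParametrizationData X W) := by
  have hiso : W₁.IsIsogenous W :=
    isIsogenous_of_lFunction_prime_eq_of_not_dvd (N₀ := 1) one_ne_zero fun ℓ _ _ => by
      have h := (D₁.isNewformOf.2 ℓ).symm.trans (hf.2 ℓ)
      exact_mod_cast h
  obtain ⟨P₁⟩ := nonempty_shimuraParametrizationData_one_of_modularParametrizationData X W₁ D₁
  exact P₁.nonempty_of_isIsogenous hiso

/-- The same at a level written `(d, M₁)` with `d = 1` and `N = d · M₁` admissible (the shape of the
intermediate levels `(D/(pr), prM)` of Pasten's §6.7–6.9). [cite: PastenShimura2024, §2 p. 12] -/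
theorem nonempty_shimuraParametrizationData_of_isNewformOf_of_eq_one {N d M₁ : ℕ} [NeZero N]
    (hd : d = 1) (hadm : IsAdmissibleFactorization N d M₁) (X₁ : ShimuraCurveData d M₁)
    (W : WeierstrassCurve ℚ) [W.IsElliptic] {W₁ : WeierstrassCurve ℚ} [W₁.IsElliptic]
    (D₁ : ModularParametrizationData W₁ N) (hf : IsNewformOf W D₁.f) :
    Nonempty (ShimuraParametrizationData X₁ W) := by
  subst hd
  have hMN : N = M₁ := by
    have := hadm.mul_eq
    rw [one_mul] at this
    exact this.symm
  subst hMN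
  exact nonempty_shimuraParametrizationData_one_of_isNewformOf X₁ W D₁ hf

/-- For distinct primes `p ≠ q`, `pq/(qp) = 1` (the level `D/(pr)` of Lemma 6.15 at `D = pq`,
`r = p`). [folklore] -/
theorem mul_div_mul_comm_eq_one {p q : ℕ} (hp : p.Prime) (hq : q.Prime) :
    p * q / (q * p) = 1 := by
  rw [mul_comm q p]
  exact Nat.div_self (Nat.mul_pos hp.pos hq.pos)

/-! ## II. Lemma 6.15 with the Jacquet–Langlands fact replaced by the one datum it uses -/

section RTSystem

variable (cI cJ : ∀ {D M : ℕ} {X : ShimuraCurveData D M} {W' : WeierstrassCurve ℚ},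
    ShimuraParametrizationData X W' → ℕ → ℕ)
  (hI : ∀ {D M : ℕ} {X : ShimuraCurveData D M} {W' : WeierstrassCurve ℚ}
    (P : ShimuraParametrizationData X W') (p : ℕ), 0 < cI P p)
  (hJ : ∀ {D M : ℕ} {X : ShimuraCurveData D M} {W' : WeierstrassCurve ℚ}
    (P : ShimuraParametrizationData X W') (p : ℕ), 0 < cJ P p)
  (h613 : ∀ {N d M₁ D M p r : ℕ}, p.Prime → r.Prime → p ≠ r → D = d * (p * r) →
    M₁ = p * r * M → IsAdmissibleFactorization N D M →
    ∀ (X₁ : ShimuraCurveData d M₁) (X₂ : ShimuraCurveData D M)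
      (W : WeierstrassCurve ℚ) [W.IsElliptic] [W.IsGloballyMinimal], W.conductorNorm ℤ = N →
    ∀ (W₁' : WeierstrassCurve ℚ) [W₁'.IsElliptic] (P₁ : ShimuraParametrizationData X₁ W₁'),
      P₁.IsMinimalFor W →
    ∀ (W₂' : WeierstrassCurve ℚ) [W₂'.IsElliptic] (P₂ : ShimuraParametrizationData X₂ W₂'),
      P₂.IsMinimalFor W →
      P₁.deg * (cI P₁ p ^ 2 * cJ P₂ r ^ 2) =
        P₂.deg * ((W₁'.minimalDiscriminantNorm ℤ).factorization p *
          (W₂'.minimalDiscriminantNorm ℤ).factorization r))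
  (hJc : ∀ {N D M : ℕ}, IsAdmissibleFactorization N D M →
    ∀ (X : ShimuraCurveData D M) (W : WeierstrassCurve ℚ) [W.IsElliptic] [W.IsGloballyMinimal],
      W.conductorNorm ℤ = N →
    ∀ (W' : WeierstrassCurve ℚ) [W'.IsElliptic] (P : ShimuraParametrizationData X W'),
      P.IsMinimalFor W → ∀ p : ℕ, p.Prime → p ∣ D →
      cJ P p ∣ (W'.minimalDiscriminantNorm ℤ).factorization p)
  (h68 : ∀ (W W' : WeierstrassCurve ℚ) [W.IsElliptic] [W'.IsElliptic], W.IsIsogenous W' →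
    ∀ p : ℕ, p.Prime → p ∣ W.conductorNorm ℤ → ¬ p ^ 2 ∣ W.conductorNorm ℤ →
      ∃ a b : ℕ, 0 < a ∧ a ≤ 163 ∧ 0 < b ∧ b ≤ 163 ∧
        (W'.minimalDiscriminantNorm ℤ).factorization p * b =
          a * (W.minimalDiscriminantNorm ℤ).factorization p)
  {S : Finset ℕ} {κ₁ : ℕ} (hκ₁ : 0 < κ₁)
  (h614 : ∀ {N D M : ℕ}, IsAdmissibleFactorization N D M →
    ∀ (X : ShimuraCurveData D M) (W : WeierstrassCurve ℚ) [W.IsElliptic] [W.IsGloballyMinimal],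
      W.conductorNorm ℤ = N → (∀ q : ℕ, q.Prime → q ∉ S → ¬ q ^ 2 ∣ N) →
    ∀ (W' : WeierstrassCurve ℚ) [W'.IsElliptic] (P : ShimuraParametrizationData X W'),
      P.IsMinimalFor W → ∀ p : ℕ, p.Prime → p ∣ M → ¬ p ^ 2 ∣ M → cI P p ∣ κ₁)

include hI hJ h613 hJc h68 hκ₁ h614 in
/-- **Pasten 2024, Lemma 6.15 (switching primes on `D`), with the Jacquet–Langlands fact replaced by
the one datum its proof uses.** Printed (p. 24): "Let `E` be an elliptic curve over `ℚ`, semi-stable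
away from `S`, and of conductor `N`. Let `N = DM` be an admissible factorization. If `p, r` are two
(possibly equal) primes dividing `D`, then for every prime `ℓ` we have
`v_ℓ(j_p(D,M)) ≤ v_ℓ(c_r(E)) + α_{S,1}(ℓ)`", here with the explicit
`α_{S,1}(ℓ) = v_ℓ(κ_S) + 3 log_ℓ 163` of the tree's `PastenShimura2024_lemma_6_15`, whose proof this
is verbatim except for ONE input: in the case `p ≠ r` the printed proof compares with the level
`(d', prM)`, `d' = D/(pr)`, through a class-minimal datum of the class of `E` on `X₀^{d'}(prM)`; the
tree's lemma takes it from `nonempty_shimuraParametrizationData`, this version takes a datum of `E`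
on that one curve as the hypothesis `hP₁` (a class-minimal one then exists,
`ShimuraParametrizationData.exists_isMinimalFor_of_nonempty`). For `D = pq` that curve is `X₀^1(N)`,
where the datum comes from the Modularity datum of the statement
(`nonempty_shimuraParametrizationData_of_isNewformOf_of_eq_one`). [cite: PastenShimura2024, Lemma 6.15 p. 24, with Prop. 6.13 and Lemma 6.14 p. 23, Lemma 6.8 p. 22] -/
theorem PastenShimura2024_lemma_6_15_of_supply {N D M : ℕ}
    (hadm : IsAdmissibleFactorization N D M) (X : ShimuraCurveData D M) (W : WeierstrassCurve ℚ)
    [W.IsElliptic] [W.IsGloballyMinimal] (hWN : W.conductorNorm ℤ = N)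
    (hS : ∀ q : ℕ, q.Prime → q ∉ S → ¬ q ^ 2 ∣ N) (W' : WeierstrassCurve ℚ) [W'.IsElliptic]
    (P : ShimuraParametrizationData X W') (hPm : P.IsMinimalFor W) {p r : ℕ} (hp : p.Prime)
    (hr : r.Prime) (hpD : p ∣ D) (hrD : r ∣ D)
    (hP₁ : p ≠ r → ∀ X₁ : ShimuraCurveData (D / (p * r)) (p * r * M),
      Nonempty (ShimuraParametrizationData X₁ W)) (ℓ : ℕ) :
    (cJ P p).factorization ℓ ≤ ((W.minimalDiscriminantNorm ℤ).factorization r).factorization ℓ +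
      κ₁.factorization ℓ + 3 * Nat.log ℓ 163 := by
  -- `p, r ∥ N`, so `c_p(E), c_r(E) ≥ 1`
  obtain ⟨hpN, hp2N⟩ := hadm.dvd_and_not_sq_dvd hp hpD
  obtain ⟨hrN, hr2N⟩ := hadm.dvd_and_not_sq_dvd hr hrD
  rw [← hWN] at hpN hp2N hrN hr2N
  have hcpE := factorization_minimalDiscriminantNorm_pos_of_dvd W hp hpN
  have hcrE := factorization_minimalDiscriminantNorm_pos_of_dvd W hr hrN
  -- the case `p = r` for the prime `r`: `v_ℓ(j_r(D,M)) ≤ v_ℓ(c_r(E)) + log_ℓ 163`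
  have hsame : ∀ {q : ℕ}, q.Prime → q ∣ D → q ∣ W.conductorNorm ℤ → ¬ q ^ 2 ∣ W.conductorNorm ℤ →
      (cJ P q).factorization ℓ ≤
        ((W.minimalDiscriminantNorm ℤ).factorization q).factorization ℓ + Nat.log ℓ 163 := by
    intro q hq hqD hqN hq2N
    obtain ⟨a, b, ha, ha', hb, hb', e⟩ := h68 W W' hPm.1 q hq hqN hq2N
    exact factorization_le_of_dvd_of_mul_eq_mul (hJc hadm X W hWN W' P hPm q hq hqD) ha ha' hb hb'
      (factorization_minimalDiscriminantNorm_pos_of_dvd W hq hqN) e ℓ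
  by_cases hpr : p = r
  · subst hpr
    exact (hsame hp hpD hpN hp2N).trans (by omega)
  -- `p ≠ r`: the level `(d', prM)`, `d' = D/(pr)`, a curve of that level and a class-minimal datum
  obtain ⟨hDd, hadm₁, -, -⟩ := hadm.erase_two_primes hp hr hpr hpD hrD
  set d' := D / (p * r)
  obtain ⟨X₁⟩ := nonempty_shimuraCurveData_holds hadm₁
  obtain ⟨W₁', hW₁', P₁, hP₁m⟩ :=
    ShimuraParametrizationData.exists_isMinimalFor_of_nonempty (hP₁ hpr X₁)
  -- Prop. 6.13 for the pairs `(p, r)` and `(r, p)`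
  have e1 := h613 hp hr hpr hDd rfl hadm X₁ X W hWN W₁' P₁ hP₁m W' P hPm
  have e2 := h613 hr hp (Ne.symm hpr) (by rw [hDd]; ring) (by ring) hadm X₁ X W hWN W₁' P₁ hP₁m
    W' P hPm
  -- Lemma 6.14 for `i_p(d', prM)`: `p ∥ prM`
  obtain ⟨-, hp1, hp2⟩ := hadm.not_sq_dvd_mul_of_dvd hp hr hpr hpD
  have hi : (cI P₁ p).factorization ℓ ≤ κ₁.factorization ℓ :=
    factorization_le_of_dvd_of_ne_zero hκ₁.ne' (h614 hadm₁ X₁ W hWN hS W₁' P₁ hP₁m p hp hp1 hp2) ℓ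
  have hswitch := factorization_le_of_two_identities P₁.deg_pos P.deg_pos (hI P₁ p) (hI P₁ r)
    (hJ P p) (hJ P r) hcpE hcrE e1 e2 (h68 W W₁' hP₁m.1 p hp hpN hp2N) (h68 W W' hPm.1 p hp hpN hp2N)
    (h68 W W₁' hP₁m.1 r hr hrN hr2N) (h68 W W' hPm.1 r hr hrN hr2N) hi
  have hjr := hsame hr hrD hrN hr2N
  omega

end RTSystem

/-! ## III. The two-prime package without `nonempty_shimuraParametrizationData` -/

/-- **Pasten 2024, the pairwise `gcd`-bounded denominator of `γ_{pq,M,E}` from its four printed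
inputs, WITHOUT the Jacquet–Langlands fact.** The tree's
`PastenShimura2024_pairwise_denominator_of_lemmas` (§6.9 (EqSequentially) p. 25 with `d = 1`,
Prop. 6.13 `h613`, Lemma 6.8 `h68`, Lemma 6.14 `h614`, Lemma 6.15 `h615`) with two changes: the
class-minimal datum on `X₀^1(N)` (Pasten's `q_{1,N} j_N`) is no longer taken from
`nonempty_shimuraParametrizationData` but produced from the statement's own classical datum `D₁`
(`nonempty_shimuraParametrizationData_one_of_isNewformOf`); and the Lemma 6.15 hypothesis is taken
in the supplied form of `PastenShimura2024_lemma_6_15_of_supply` (a datum of `E` on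
`X₀^{D/(pr)}(prM)` as a premise, needed for `p ≠ r` only), which at `D = pq`, `r = p` is again the
datum on `X₀^1(N)` from `D₁`. Otherwise the proof is the tree's, verbatim.
[cite: PastenShimura2024, §6.9 (EqSequentially) p. 25 with d = 1, Prop. 6.13 p. 23, Lemma 6.8 p. 22, Lemma 6.14 p. 23, Lemma 6.15 p. 24] -/
theorem PastenShimura2024_pairwise_denominator_of_lemmas_of_supply
    (cI cJ : ∀ {D M : ℕ} {X : ShimuraCurveData D M} {W' : WeierstrassCurve ℚ},
      ShimuraParametrizationData X W' → ℕ → ℕ)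
    (hI : ∀ {D M : ℕ} {X : ShimuraCurveData D M} {W' : WeierstrassCurve ℚ}
      (P : ShimuraParametrizationData X W') (p : ℕ), 0 < cI P p)
    (hJ : ∀ {D M : ℕ} {X : ShimuraCurveData D M} {W' : WeierstrassCurve ℚ}
      (P : ShimuraParametrizationData X W') (p : ℕ), 0 < cJ P p)
    (h613 : ∀ {N d M₁ D M p r : ℕ}, p.Prime → r.Prime → p ≠ r → D = d * (p * r) →
      M₁ = p * r * M → IsAdmissibleFactorization N D M →
      ∀ (X₁ : ShimuraCurveData d M₁) (X₂ : ShimuraCurveData D M)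
        (W : WeierstrassCurve ℚ) [W.IsElliptic] [W.IsGloballyMinimal], W.conductorNorm ℤ = N →
      ∀ (W₁' : WeierstrassCurve ℚ) [W₁'.IsElliptic] (P₁ : ShimuraParametrizationData X₁ W₁'),
        P₁.IsMinimalFor W →
      ∀ (W₂' : WeierstrassCurve ℚ) [W₂'.IsElliptic] (P₂ : ShimuraParametrizationData X₂ W₂'),
        P₂.IsMinimalFor W →
        P₁.deg * (cI P₁ p ^ 2 * cJ P₂ r ^ 2) =
          P₂.deg * ((W₁'.minimalDiscriminantNorm ℤ).factorization p *
            (W₂'.minimalDiscriminantNorm ℤ).factorization r))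
    (h68 : ∀ (W W' : WeierstrassCurve ℚ) [W.IsElliptic] [W'.IsElliptic], W.IsIsogenous W' →
      ∀ p : ℕ, p.Prime → p ∣ W.conductorNorm ℤ → ¬ p ^ 2 ∣ W.conductorNorm ℤ →
        ∃ a b : ℕ, 0 < a ∧ a ≤ 163 ∧ 0 < b ∧ b ≤ 163 ∧
          (W'.minimalDiscriminantNorm ℤ).factorization p * b =
            a * (W.minimalDiscriminantNorm ℤ).factorization p)
    (h614 : ∀ S : Finset ℕ, ∃ κ₁ : ℕ, 1 ≤ κ₁ ∧
      ∀ {N D M : ℕ}, IsAdmissibleFactorization N D M →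
      ∀ (X : ShimuraCurveData D M) (W : WeierstrassCurve ℚ) [W.IsElliptic] [W.IsGloballyMinimal],
        W.conductorNorm ℤ = N → (∀ q : ℕ, q.Prime → q ∉ S → ¬ q ^ 2 ∣ N) →
      ∀ (W' : WeierstrassCurve ℚ) [W'.IsElliptic] (P : ShimuraParametrizationData X W'),
        P.IsMinimalFor W → ∀ p : ℕ, p.Prime → p ∣ M → ¬ p ^ 2 ∣ M → cI P p ∣ κ₁)
    (h615 : ∀ S : Finset ℕ, ∃ α : ℕ → ℕ, (∀ ℓ : ℕ, ℓ.Prime → 164 ≤ ℓ → α ℓ = 0) ∧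
      ∀ {N D M : ℕ}, IsAdmissibleFactorization N D M →
      ∀ (X : ShimuraCurveData D M) (W : WeierstrassCurve ℚ) [W.IsElliptic] [W.IsGloballyMinimal],
        W.conductorNorm ℤ = N → (∀ q : ℕ, q.Prime → q ∉ S → ¬ q ^ 2 ∣ N) →
      ∀ (W' : WeierstrassCurve ℚ) [W'.IsElliptic] (P : ShimuraParametrizationData X W'),
        P.IsMinimalFor W → ∀ {p r : ℕ}, p.Prime → r.Prime → p ∣ D → r ∣ D →
        (p ≠ r → ∀ X₁ : ShimuraCurveData (D / (p * r)) (p * r * M),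
          Nonempty (ShimuraParametrizationData X₁ W)) →
        ∀ ℓ : ℕ, ℓ.Prime → (cJ P p).factorization ℓ ≤
          ((W.minimalDiscriminantNorm ℤ).factorization r).factorization ℓ + α ℓ) :
    PastenShimura2024_pairwise_denominator := by
  intro S
  obtain ⟨κ₁, hκ₁, h614S⟩ := h614 S
  obtain ⟨α, hα0, h615S⟩ := h615 S
  -- the constant `κ' = ∏_{ℓ ≤ 163} ℓ^{α_{S,1}(ℓ)}` of Lemma 6.15, and `κ = 163² κ_S² κ'²`
  set K := ∏ ℓ ∈ (Finset.range 164).filter Nat.Prime, ℓ ^ α ℓ with hK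
  have hK1 : 1 ≤ K := (one_le_prod_pow_and_primeFactors_lt 164 α).1
  refine ⟨163 ^ 2 * κ₁ ^ 2 * K ^ 2, Nat.one_le_iff_ne_zero.mpr (mul_ne_zero (mul_ne_zero
    (pow_ne_zero 2 (by norm_num)) (pow_ne_zero 2 (by omega))) (pow_ne_zero 2 (by omega))), ?_⟩
  intro N M p q _ hp hq hpq hadm X W _ _ hWN hS W₁ _ D₁ hf hmin W' _ P hPm
  -- `p, q ∥ N`, so `c_p(E), c_q(E) ≥ 1`
  have hpD : p ∣ p * q := Dvd.intro q rfl
  have hqD : q ∣ p * q := Dvd.intro_left p rfl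
  obtain ⟨hpN, hp2N⟩ := hadm.dvd_and_not_sq_dvd hp hpD
  obtain ⟨hqN, hq2N⟩ := hadm.dvd_and_not_sq_dvd hq hqD
  have hpN' : p ∣ W.conductorNorm ℤ := hWN ▸ hpN
  have hp2N' : ¬ p ^ 2 ∣ W.conductorNorm ℤ := hWN ▸ hp2N
  have hqN' : q ∣ W.conductorNorm ℤ := hWN ▸ hqN
  have hq2N' : ¬ q ^ 2 ∣ W.conductorNorm ℤ := hWN ▸ hq2N
  have hcpE := factorization_minimalDiscriminantNorm_pos_of_dvd W hp hpN'
  have hcqE := factorization_minimalDiscriminantNorm_pos_of_dvd W hq hqN'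
  -- the level `(1, N)`: `X₀^1(N)`, a class-minimal datum on it (from `D₁`), and the bridge
  have hadm₁ : IsAdmissibleFactorization N 1 N := isAdmissibleFactorization_one hadm.pos
  obtain ⟨X₁⟩ := nonempty_shimuraCurveData_holds hadm₁
  obtain ⟨W₁', hW₁', P₁, hP₁⟩ := ShimuraParametrizationData.exists_isMinimalFor_of_nonempty
    (nonempty_shimuraParametrizationData_one_of_isNewformOf X₁ W D₁ hf)
  have hδ : P₁.deg = D₁.modularDegree := hP₁.deg_eq_modularDegree D₁ hf hmin
  -- Prop. 6.13 at `d = 1`, `D = pq`: `δ_{1,N} i_p(1,N)² j_q(pq,M)² = δ_{pq,M} c_p(A_{1,N}) c_q(A_{pq,M})`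
  have e613 := h613 hp hq hpq (one_mul (p * q)).symm hadm.mul_eq.symm hadm X₁ X W hWN W₁' P₁ hP₁
    W' P hPm
  -- Lemma 6.14: `i_p(1,N) ∣ κ_S` (`N = 1 · N` squarefree away from `S`, `p ∥ N`)
  have hi : cI P₁ p ∣ κ₁ := h614S hadm₁ X₁ W hWN hS W₁' P₁ hP₁ p hp hpN hp2N
  -- the datum on `X₀^{pq/(qp)}(qpM) = X₀^1(N)` used by Lemma 6.15 at `D = pq`, `r = p` (from `D₁`)
  have hsup : q ≠ p → ∀ X₂ : ShimuraCurveData (p * q / (q * p)) (q * p * M),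
      Nonempty (ShimuraParametrizationData X₂ W) := fun _ X₂ =>
    nonempty_shimuraParametrizationData_of_isNewformOf_of_eq_one (mul_div_mul_comm_eq_one hp hq)
      (hadm.erase_two_primes hq hp (Ne.symm hpq) hqD hpD).2.1 X₂ W D₁ hf
  -- Lemma 6.15 at `D = pq` for `j_q(pq,M)`, against `r = p` and `r = q`: `j ∣ κ' gcd(c_p, c_q)`
  have hjdvd : cJ P q ∣ Nat.gcd ((W.minimalDiscriminantNorm ℤ).factorization p)
      ((W.minimalDiscriminantNorm ℤ).factorization q) * K :=
    dvd_gcd_mul_prod_pow_of_factorization_le (hJ P q).ne' hcpE.ne' hcqE.ne'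
      (h615S hadm X W hWN hS W' P hPm hq hp hqD hpD hsup)
      (h615S hadm X W hWN hS W' P hPm hq hq hqD hqD fun h => absurd rfl h) hα0
  -- Lemma 6.8 for `A_{1,N}` at `p` and `A_{pq,M}` at `q`
  obtain ⟨a₁, b₁, ha₁, ha₁', hb₁, hb₁', e₁⟩ := h68 W W₁' hP₁.1 p hp hpN' hp2N'
  obtain ⟨a₂, b₂, ha₂, ha₂', hb₂, hb₂', e₂⟩ := h68 W W' hPm.1 q hq hqN' hq2N'
  set i := cI P₁ p
  set j := cJ P q
  set cp := (W.minimalDiscriminantNorm ℤ).factorization p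
  set cq := (W.minimalDiscriminantNorm ℤ).factorization q
  set c₁ := (W₁'.minimalDiscriminantNorm ℤ).factorization p
  set c₂ := (W'.minimalDiscriminantNorm ℤ).factorization q
  set g := Nat.gcd cp cq
  have hile : i ≤ κ₁ := Nat.le_of_dvd hκ₁ hi
  have hjle : j ≤ g * K := Nat.le_of_dvd (Nat.mul_pos (Nat.gcd_pos_of_pos_left _ hcpE) hK1) hjdvd
  refine ⟨a₁ * a₂, i ^ 2 * j ^ 2 * (b₁ * b₂), Nat.mul_pos ha₁ ha₂,
    Nat.mul_pos (Nat.mul_pos (pow_pos (hI P₁ p) 2) (pow_pos (hJ P q) 2)) (Nat.mul_pos hb₁ hb₂),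
    ?_, ?_, ?_⟩
  · -- `a = a₁ a₂ ≤ 163²`
    rw [sq]
    exact Nat.mul_le_mul ha₁' ha₂'
  · -- `b = i² j² b₁ b₂ ≤ κ_S² (κ' gcd)² 163² = κ gcd²`
    calc i ^ 2 * j ^ 2 * (b₁ * b₂) ≤ κ₁ ^ 2 * (g * K) ^ 2 * (163 * 163) :=
          Nat.mul_le_mul (Nat.mul_le_mul (Nat.pow_le_pow_left hile 2) (Nat.pow_le_pow_left hjle 2))
            (Nat.mul_le_mul hb₁' hb₂')
      _ = 163 ^ 2 * κ₁ ^ 2 * K ^ 2 * g ^ 2 := by ring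
  · -- the identity `δ_{1,N} b = a δ_{pq,M} c_p(E) c_q(E)`
    calc D₁.modularDegree * (i ^ 2 * j ^ 2 * (b₁ * b₂))
        = P₁.deg * (i ^ 2 * j ^ 2) * (b₁ * b₂) := by rw [← hδ]; ring
      _ = P.deg * (c₁ * c₂) * (b₁ * b₂) := by rw [e613]
      _ = P.deg * ((c₁ * b₁) * (c₂ * b₂)) := by ring
      _ = P.deg * ((a₁ * cp) * (a₂ * cq)) := by rw [e₁, e₂]
      _ = a₁ * a₂ * P.deg * (cp * cq) := by ring

/-- **Pasten 2024, the pairwise denominator from Ribet–Takahashi's Prop. 6.13, "`j_p ∣ c_p(A_{D,M})`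
by definition", Lemma 6.8 and Lemma 6.14, WITHOUT the Jacquet–Langlands fact** — the tree's
`PastenShimura2024_pairwise_denominator_of_ribetTakahashi_inputs` minus `hP`: Lemma 6.15 is
performed by `PastenShimura2024_lemma_6_15_of_supply` (explicit
`α_{S,1}(ℓ) = v_ℓ(κ_S) + 3 log_ℓ 163`, vanishing at primes `ℓ > 163` since `κ_S` is supported on
primes `≤ 163`), and the datum on `X₀^1(N)` comes from the statement's `D₁`.
[cite: PastenShimura2024, §6.9 (EqSequentially) p. 25 with d = 1, Prop. 6.13 and Lemma 6.14 p. 23, Lemma 6.15 p. 24 (statement and proof), Lemma 6.8 p. 22] -/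
theorem PastenShimura2024_pairwise_denominator_of_ribetTakahashi_inputs_noJL
    (cI cJ : ∀ {D M : ℕ} {X : ShimuraCurveData D M} {W' : WeierstrassCurve ℚ},
      ShimuraParametrizationData X W' → ℕ → ℕ)
    (hI : ∀ {D M : ℕ} {X : ShimuraCurveData D M} {W' : WeierstrassCurve ℚ}
      (P : ShimuraParametrizationData X W') (p : ℕ), 0 < cI P p)
    (hJ : ∀ {D M : ℕ} {X : ShimuraCurveData D M} {W' : WeierstrassCurve ℚ}
      (P : ShimuraParametrizationData X W') (p : ℕ), 0 < cJ P p)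
    (h613 : ∀ {N d M₁ D M p r : ℕ}, p.Prime → r.Prime → p ≠ r → D = d * (p * r) →
      M₁ = p * r * M → IsAdmissibleFactorization N D M →
      ∀ (X₁ : ShimuraCurveData d M₁) (X₂ : ShimuraCurveData D M)
        (W : WeierstrassCurve ℚ) [W.IsElliptic] [W.IsGloballyMinimal], W.conductorNorm ℤ = N →
      ∀ (W₁' : WeierstrassCurve ℚ) [W₁'.IsElliptic] (P₁ : ShimuraParametrizationData X₁ W₁'),
        P₁.IsMinimalFor W →
      ∀ (W₂' : WeierstrassCurve ℚ) [W₂'.IsElliptic] (P₂ : ShimuraParametrizationData X₂ W₂'),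
        P₂.IsMinimalFor W →
        P₁.deg * (cI P₁ p ^ 2 * cJ P₂ r ^ 2) =
          P₂.deg * ((W₁'.minimalDiscriminantNorm ℤ).factorization p *
            (W₂'.minimalDiscriminantNorm ℤ).factorization r))
    (hJc : ∀ {N D M : ℕ}, IsAdmissibleFactorization N D M →
      ∀ (X : ShimuraCurveData D M) (W : WeierstrassCurve ℚ) [W.IsElliptic] [W.IsGloballyMinimal],
        W.conductorNorm ℤ = N →
      ∀ (W' : WeierstrassCurve ℚ) [W'.IsElliptic] (P : ShimuraParametrizationData X W'),
        P.IsMinimalFor W → ∀ p : ℕ, p.Prime → p ∣ D →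
        cJ P p ∣ (W'.minimalDiscriminantNorm ℤ).factorization p)
    (h68 : ∀ (W W' : WeierstrassCurve ℚ) [W.IsElliptic] [W'.IsElliptic], W.IsIsogenous W' →
      ∀ p : ℕ, p.Prime → p ∣ W.conductorNorm ℤ → ¬ p ^ 2 ∣ W.conductorNorm ℤ →
        ∃ a b : ℕ, 0 < a ∧ a ≤ 163 ∧ 0 < b ∧ b ≤ 163 ∧
          (W'.minimalDiscriminantNorm ℤ).factorization p * b =
            a * (W.minimalDiscriminantNorm ℤ).factorization p)
    (h614 : ∀ S : Finset ℕ, ∃ κ₁ : ℕ, 1 ≤ κ₁ ∧ (∀ q ∈ κ₁.primeFactors, q ≤ 163) ∧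
      ∀ {N D M : ℕ}, IsAdmissibleFactorization N D M →
      ∀ (X : ShimuraCurveData D M) (W : WeierstrassCurve ℚ) [W.IsElliptic] [W.IsGloballyMinimal],
        W.conductorNorm ℤ = N → (∀ q : ℕ, q.Prime → q ∉ S → ¬ q ^ 2 ∣ N) →
      ∀ (W' : WeierstrassCurve ℚ) [W'.IsElliptic] (P : ShimuraParametrizationData X W'),
        P.IsMinimalFor W → ∀ p : ℕ, p.Prime → p ∣ M → ¬ p ^ 2 ∣ M → cI P p ∣ κ₁) :
    PastenShimura2024_pairwise_denominator := by
  refine PastenShimura2024_pairwise_denominator_of_lemmas_of_supply cI cJ hI hJ h613 h68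
    (fun S => ?_) (fun S => ?_)
  · obtain ⟨κ₁, hκ₁, -, h614S⟩ := h614 S
    exact ⟨κ₁, hκ₁, h614S⟩
  · obtain ⟨κ₁, hκ₁, hκ₁', h614S⟩ := h614 S
    refine ⟨fun ℓ => κ₁.factorization ℓ + 3 * Nat.log ℓ 163, fun ℓ hℓ h164 => ?_, ?_⟩
    · -- `α_{S,1}(ℓ) = v_ℓ(κ_S) + 3 log_ℓ 163 = 0` for `ℓ ≥ 164`
      have h1 : κ₁.factorization ℓ = 0 := by
        apply Finsupp.notMem_support_iff.mp
        rw [Nat.support_factorization]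
        exact fun hmem => absurd (hκ₁' ℓ hmem) (by omega)
      have h2 : Nat.log ℓ 163 = 0 := Nat.log_of_lt (by omega)
      show κ₁.factorization ℓ + 3 * Nat.log ℓ 163 = 0
      rw [h1, h2]
    · intro N D M hadm X W _ _ hWN hS W' _ P hPm p r hp hr hpD hrD hP₁ ℓ _
      have h15 := PastenShimura2024_lemma_6_15_of_supply cI cJ hI hJ h613 hJc h68 (by omega) h614S
        hadm X W hWN hS W' P hPm hp hr hpD hrD hP₁ ℓ
      show _ ≤ _ + (κ₁.factorization ℓ + 3 * Nat.log ℓ 163)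
      omega

/-- **Pasten 2024, the pairwise `gcd`-bounded denominator of `γ_{pq,M,E}` over the tree's facts,
WITHOUT the Jacquet–Langlands fact — the exact list of external inputs.** The tree's trust base
`PastenShimura2024_pairwise_denominator_of_ribetTakahashi_eisenstein_mazurKenku` (Lemma 6.14
performed from the Eisenstein divisibility `hEis` and Lemma 6.7 `h67`, `PastenShimura2024_lemma_6_14`;
Lemma 6.8 discharged from `mazurKenku_exists_cyclic_isogeny`) minus `nonempty_shimuraParametrizationData`.
So the discharge `PastenShimura2024_pairwise_denominator_holds` waits exactly for: the vocabulary of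
Néron models / component groups `Φ_p` of `J₀^D(M)` and of the optimal quotient `q_{D,M}` defining
`cI`, `cJ`, and over it `h613` (Ribet–Takahashi 1997, Thm. 2), `hJc`, `hEis` (Ribet) and `h67`
(Pasten's Lemma 6.7); and the named fact `mazurKenku_exists_cyclic_isogeny`. Neither the Modularity
theorem (the statement carries its own classical datum `D₁`) nor Jacquet–Langlands is among them.
[cite: PastenShimura2024, §6.9 (EqSequentially) p. 25 with d = 1, §6.3 Lemma 6.7 and §6.4 Lemma 6.8 p. 22, Prop. 6.13 and Lemma 6.14 p. 23, Lemma 6.15 p. 24, §2 p. 12] [cite: RibetTakahashi1997, Thm. 2] [cite: Mazur1978, Thm. 1] [cite: Kenku1982] -/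
theorem PastenShimura2024_pairwise_denominator_of_ribetTakahashi_eisenstein_mazurKenku_noJL
    (hMK : mazurKenku_exists_cyclic_isogeny)
    (cI cJ : ∀ {D M : ℕ} {X : ShimuraCurveData D M} {W' : WeierstrassCurve ℚ},
      ShimuraParametrizationData X W' → ℕ → ℕ)
    (hI : ∀ {D M : ℕ} {X : ShimuraCurveData D M} {W' : WeierstrassCurve ℚ}
      (P : ShimuraParametrizationData X W') (p : ℕ), 0 < cI P p)
    (hJ : ∀ {D M : ℕ} {X : ShimuraCurveData D M} {W' : WeierstrassCurve ℚ}
      (P : ShimuraParametrizationData X W') (p : ℕ), 0 < cJ P p)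
    (h613 : ∀ {N d M₁ D M p r : ℕ}, p.Prime → r.Prime → p ≠ r → D = d * (p * r) →
      M₁ = p * r * M → IsAdmissibleFactorization N D M →
      ∀ (X₁ : ShimuraCurveData d M₁) (X₂ : ShimuraCurveData D M)
        (W : WeierstrassCurve ℚ) [W.IsElliptic] [W.IsGloballyMinimal], W.conductorNorm ℤ = N →
      ∀ (W₁' : WeierstrassCurve ℚ) [W₁'.IsElliptic] (P₁ : ShimuraParametrizationData X₁ W₁'),
        P₁.IsMinimalFor W →
      ∀ (W₂' : WeierstrassCurve ℚ) [W₂'.IsElliptic] (P₂ : ShimuraParametrizationData X₂ W₂'),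
        P₂.IsMinimalFor W →
        P₁.deg * (cI P₁ p ^ 2 * cJ P₂ r ^ 2) =
          P₂.deg * ((W₁'.minimalDiscriminantNorm ℤ).factorization p *
            (W₂'.minimalDiscriminantNorm ℤ).factorization r))
    (hJc : ∀ {N D M : ℕ}, IsAdmissibleFactorization N D M →
      ∀ (X : ShimuraCurveData D M) (W : WeierstrassCurve ℚ) [W.IsElliptic] [W.IsGloballyMinimal],
        W.conductorNorm ℤ = N →
      ∀ (W' : WeierstrassCurve ℚ) [W'.IsElliptic] (P : ShimuraParametrizationData X W'),
        P.IsMinimalFor W → ∀ p : ℕ, p.Prime → p ∣ D →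
        cJ P p ∣ (W'.minimalDiscriminantNorm ℤ).factorization p)
    (hEis : ∀ {N D M : ℕ}, IsAdmissibleFactorization N D M →
      ∀ (X : ShimuraCurveData D M) (W : WeierstrassCurve ℚ) [W.IsElliptic] [W.IsGloballyMinimal],
        W.conductorNorm ℤ = N →
      ∀ (W' : WeierstrassCurve ℚ) [W'.IsElliptic] (P : ShimuraParametrizationData X W'),
        P.IsMinimalFor W → ∀ p : ℕ, p.Prime → p ∣ M → ¬ p ^ 2 ∣ M →
        ∀ r : ℕ, r.Prime → ¬ r ∣ N → (cI P p : ℤ) ∣ (r + 1 : ℤ) - W'.LFunction r)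
    (h67 : ∀ (S : Finset ℕ) (ℓ : ℕ), ℓ.Prime → ∃ β : ℕ, (163 < ℓ → β = 1) ∧
      ∀ (A : WeierstrassCurve ℚ) [A.IsElliptic],
        (∀ q : ℕ, q.Prime → q ∉ S → ¬ q ^ 2 ∣ A.conductorNorm ℤ) →
        ∀ r₀ : ℕ, ∃ r : ℕ, r₀ < r ∧ r.Prime ∧ ¬ ((ℓ ^ β : ℕ) : ℤ) ∣ (r + 1 : ℤ) - A.LFunction r) :
    PastenShimura2024_pairwise_denominator :=
  PastenShimura2024_pairwise_denominator_of_ribetTakahashi_inputs_noJL cI cJ hI hJ h613 hJc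
    (fun W W' _ _ hiso p hp hpN hp2 =>
      lemma_6_8_factorization_form (PastenShimura2024_lemma_6_8_of_mazurKenku' hMK) W W' hiso p hp
        hpN hp2)
    (fun S => PastenShimura2024_lemma_6_14 cI hI hEis (h67 S))

end Literature.NumberTheory.Automorphic

end
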